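import Literature.NumberTheory.Automorphic.UnitaryGroupDirectSum
import Literature.NumberTheory.Automorphic.UnitaryGroupFormTransport
import HarnessLib

/-!
# Congruence transforms of hermitian forms under products, scalars and block-diagonal frames

Elementary matrix algebra of the congruence transform `formCongr σ B H = ᵗσ(B)·H·B` of a (hermitian) form `H` by a frame
`B ∈ GL_n` and of the orthogonal sum `finSum N₁ N₂ J₁ J₂ = J₁ ⊕ᶠ J₂` on the concatenated basis `Fin (N₁ + N₂)`
(`Literature.NumberTheory.Automorphic.UnitaryGroupDirectSum`):

* `formCongr_mul_eq` — `ᵗσ(BC)·H·(BC) = ᵗσ(C)·(ᵗσ(B)·H·B)·C` (congruence by a product is iterated congruence);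
* `formCongr_smul_eq` — `ᵗσ(B)·(r H)·B = r · ᵗσ(B)·H·B`;
* `formCongr_one_eq` — congruence by the identity frame is the identity;
* `formCongr_reindexGL_blockDiagGL_finSum` — a block-diagonal frame `g₁ ⊕ g₂` acts blockwise on an orthogonal sum:
  `ᵗσ(g₁ ⊕ g₂)·(J₁ ⊕ᶠ J₂)·(g₁ ⊕ g₂) = (ᵗσ(g₁) J₁ g₁) ⊕ᶠ (ᵗσ(g₂) J₂ g₂)`;
* `finSum_smul` — `(r J₁) ⊕ᶠ (r J₂) = r · (J₁ ⊕ᶠ J₂)`;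
* `finSum_diagonal` — `diag d₁ ⊕ᶠ diag d₂ = diag (d₁ ‖ d₂)` (`Fin.append`).

These are the change-of-frame identities used when a hermitian space is split as an orthogonal sum `V = V⋆ ⊕ V⋆^⊥` and
each summand is diagonalised separately (transport of unitary groups under a change of basis, [PlatonovRapinchuk1994, §2.3];
see-saw / orthogonal-sum embeddings `U(J₁) × U(J₂) ↪ U(J₁ ⊕ J₂)`, [Kudla1984, §1]).

Special-purpose copies of two of these identities already exist next to their consumers
(`UnitaryBallUniformisationDatum.formCongr_smul`, `UnitaryBallUniformisationDatum.smul_finSum` in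
`Literature/AlgebraicGeometry/ShimuraVarieties/UnitaryBallSpecialCurveDatumOfCode.lean`); this file is the generic,
import-light home in the `UnitaryGroup` namespace.  The `1 × 1` case `X = diag (X 0 0)` is
`UnitaryGroup.eq_diagonal_of_fin_one` (`UnitaryGroupPairCharactersDet.lean`) and is deliberately NOT restated here.

## References
* [PlatonovRapinchuk1994] V. Platonov, A. Rapinchuk, *Algebraic Groups and Number Theory* (1994), §2.3.
* [Kudla1984] S. Kudla, *Seesaw dual reductive pairs*, Progr. Math. 46 (1984), §1.
-/

set_option autoImplicit false

open scoped Matrix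

namespace Literature.NumberTheory.Automorphic.UnitaryGroup

section Algebra

variable {S : Type*} [CommRing S] (σ : S →+* S)

/-- `formCongr` of a product: `ᵗσ(BC)·H·(BC) = ᵗσ(C)·(ᵗσ(B)·H·B)·C` — congruence by a product of frames is the iterated
congruence. [cite: PlatonovRapinchuk1994, §2.3] -/
theorem formCongr_mul_eq {n : Type*} [Fintype n] [DecidableEq n] (B C : GL n S) (H : Matrix n n S) :
    formCongr σ (B * C) H = formCongr σ C (formCongr σ B H) := by
  simp only [formCongr, Units.val_mul, Matrix.map_mul, Matrix.transpose_mul, Matrix.mul_assoc]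

/-- `formCongr` is linear in the form: `ᵗσ(B)·(r H)·B = r · ᵗσ(B)·H·B`. [cite: PlatonovRapinchuk1994, §2.3] -/
theorem formCongr_smul_eq {n : Type*} [Fintype n] [DecidableEq n] (B : GL n S) (r : S) (H : Matrix n n S) :
    formCongr σ B (r • H) = r • formCongr σ B H := by
  simp only [formCongr, Matrix.mul_smul, Matrix.smul_mul]

/-- `formCongr` by the identity frame is the identity: `ᵗσ(1)·H·1 = H`. [cite: PlatonovRapinchuk1994, §2.3] -/
theorem formCongr_one_eq {n : Type*} [Fintype n] [DecidableEq n] (H : Matrix n n S) : formCongr σ (1 : GL n S) H = H := by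
  simp only [formCongr, Units.val_one, Matrix.map_one σ (map_zero σ) (map_one σ), Matrix.transpose_one, Matrix.one_mul,
    Matrix.mul_one]

/-- **block-diagonal congruence acts blockwise on an orthogonal sum**:
`ᵗσ(g₁ ⊕ g₂)·(J₁ ⊕ᶠ J₂)·(g₁ ⊕ g₂) = (ᵗσ(g₁) J₁ g₁) ⊕ᶠ (ᵗσ(g₂) J₂ g₂)`. [cite: Kudla1984, §1] -/
theorem formCongr_reindexGL_blockDiagGL_finSum {N₁ N₂ : ℕ} (g₁ : GL (Fin N₁) S) (g₂ : GL (Fin N₂) S)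
    (J₁ : Matrix (Fin N₁) (Fin N₁) S) (J₂ : Matrix (Fin N₂) (Fin N₂) S) :
    formCongr σ (UnitaryGroup.reindexGL finSumFinEquiv (blockDiagGL (g₁, g₂))) (finSum N₁ N₂ J₁ J₂) =
      finSum N₁ N₂ (formCongr σ g₁ J₁) (formCongr σ g₂ J₂) := by
  simp only [formCongr, UnitaryGroup.coe_reindexGL, coe_blockDiagGL, finSum, Matrix.reindex_apply]
  simp only [← Matrix.submatrix_map, Matrix.transpose_submatrix, Matrix.submatrix_mul_equiv]
  simp only [Matrix.fromBlocks_map, Matrix.fromBlocks_transpose, Matrix.fromBlocks_multiply, Matrix.map_zero σ (map_zero σ),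
    Matrix.transpose_zero, Matrix.mul_zero, Matrix.zero_mul, add_zero, zero_add]

/-- `(r J₁) ⊕ᶠ (r J₂) = r · (J₁ ⊕ᶠ J₂)`: the orthogonal sum commutes with scalars. [cite: Kudla1984, §1] -/
theorem finSum_smul {N₁ N₂ : ℕ} (r : S) (J₁ : Matrix (Fin N₁) (Fin N₁) S) (J₂ : Matrix (Fin N₂) (Fin N₂) S) :
    finSum N₁ N₂ (r • J₁) (r • J₂) = r • finSum N₁ N₂ J₁ J₂ := by
  rw [finSum, finSum, show Matrix.fromBlocks (r • J₁) 0 0 (r • J₂) = r • Matrix.fromBlocks J₁ 0 0 J₂ by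
    simp only [Matrix.fromBlocks_smul, smul_zero]]
  ext i j
  simp only [Matrix.reindex_apply, Matrix.submatrix_apply, Matrix.smul_apply]

/-- **`(diag d₁) ⊕ᶠ (diag d₂) = diag (d₁ ‖ d₂)`**: the orthogonal sum of two diagonal forms is the diagonal form on the
concatenated basis (`Fin.append`). [cite: Kudla1984, §1] -/
theorem finSum_diagonal {N₁ N₂ : ℕ} (d₁ : Fin N₁ → S) (d₂ : Fin N₂ → S) :
    finSum N₁ N₂ (Matrix.diagonal d₁) (Matrix.diagonal d₂) = Matrix.diagonal (Fin.append d₁ d₂) := by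
  rw [finSum, Matrix.fromBlocks_diagonal, Matrix.reindex_apply, Matrix.submatrix_diagonal_equiv]
  congr 1
  funext i
  obtain ⟨x, rfl⟩ := finSumFinEquiv.surjective i
  simp only [Function.comp_apply, Equiv.symm_apply_apply]
  rcases x with j | j
  · rw [Sum.elim_inl, finSumFinEquiv_apply_left, Fin.append_left]
  · rw [Sum.elim_inr, finSumFinEquiv_apply_right, Fin.append_right]

end Algebra

end Literature.NumberTheory.Automorphic.UnitaryGroup
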